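import Summits.QuantumFields.YangMills.Theorems.LuscherReductionDressedRitzPolyakovLiftStaticsOfIsometry
import Summits.QuantumFields.YangMills.Theorems.LuscherReductionDressedRitzPolyakovLiftPScalingLevels
import Summits.QuantumFields.YangMills.Theorems.LuscherReductionDressedRitzPlateauCertificates
import HarnessLib

/-!
# Line «polyakovlift» r7 on crux `DressedRitz` (stmt-QuantumFields-20205): S-STAT (o2) from TIME-2 and TIME-1 DIAGONAL data — the SPECTRAL interface

Fleet-service module of seat ym-infvol-p1 g8 (count-neutral, `--supports stmt-QuantumFields-20205`).  The seat's lineage settled clause (o2)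
`|⟨u_i,u_l⟩| ≤ Cλ√n_i√n_l` of `StaticsForL (TransplantBasisLR k)` EXACTLY for symmetry-separated pairs (`…TransplantFlatCert`) and typed the GRAM ∕
NEAR-ISOMETRY interface for the rest (`…StaticsOfGram`, `…StaticsOfIsometry`).  This file proves sufficient a second, purely SPECTRAL interface that uses
only DIAGONAL (single-channel) data of the other two clause groups:
* §1 `abs_l2_le_of_residual_gap` — `K = K_β` symmetric on physical functions, `d̂_u = ⟨u,Ku⟩/‖u‖²`, `r_u = Ku − d̂_u u`, variance
  `V_u = ‖Ku‖²‖u‖² − ⟨u,Ku⟩² = ‖u‖²‖r_u‖²` (the left side of LEAKAGE (o4)); `(d̂_u − d̂_v)⟨u,v⟩ = ⟨u,r_v⟩ − ⟨r_u,v⟩`, so `V ≤ ρ²‖·‖⁴` for both and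
  `0 < γ ≤ |d̂_u − d̂_v|` give `|⟨u,v⟩| ≤ (2ρ/γ)‖u‖‖v‖` (almost-eigenvectors with separated Rayleigh quotients are almost orthogonal; Cauchy–Schwarz only);
* §2 pure real: `rayleighGap_of_position` (the two halves of POSITION (o5) turn a one-site level gap into a Rayleigh gap), `gap_through_slack`,
  `rayleighSep_window` (the closed crux ONE's uniform gap `c_gap·ν·λ_b`, `PScal.levels_package`, survives the (o5) slack `e^{±C₅λ²/L}`);
* §3 ★ `staticClauses_of_sharpLeakage_rayleighSep` — (o0) + sharp (o4) at rate `λ⁴/L²` ∀ channels + per pair `PairSeparated ∨` Rayleigh gap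
  `γ₀(λ/L)λ₀ ≤ |d̂_i − d̂_l|` ⟹ `StaticClauses k (2√C₄/γ₀) β u`;
* §4 ★★ `staticsForLR_of_leakageRayleighCert k`, ★★ `staticsForLR_of_leakagePositionCert k` — the r7 stub text from (sharp (o4) ∀ channels + per pair
  `PairSeparated ∨` Rayleigh gap), resp. (sharp (o4) + (o5) ∀ channels VERBATIM as in `DynamicCoreClauses` + per pair `PairSeparated ∨
  physLevel (i+2) ≠ physLevel (l+2)`), the level gaps DISCHARGED by the closed crux ONE and (o0) by `o0_level_transplantLR`.

WHY THE RATE `λ⁴`: at the REGISTERED leakage rate `λ³/L²` the residuals `≍ λ^{3/2}λ₀/L` against gaps `≍ (λ/L)λ₀` bound the mixing only by `√λ`, and (o4) at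
rate `λ³` with (o5)(o6)(o7) does NOT imply (o2) at rate `λ` (two channels mixed symmetrically at amplitude `c√λ` pass (o4)–(o7), fail (o2)); first-order
mixing `O(λ)` against gaps `O(λ/L)` IS the rate `λ⁴/L²`, at which (o2) for every pair in DISTINCT one-site levels is a corollary of single-channel data.
HONEST FRAMING: interface bookkeeping on ONE stub of ONE line of the conditional femto rung R2b1; the sharp leakage and the ∀-basis position inputs are
renormalisation-group content NOT proved here; not infinite volume, not a gap, not Clay.  References: M. Lüscher, NPB 219 (1983) 233 [cite: Luscher1983, §3];
M. Lüscher, U. Wolff, NPB 339 (1990) 222 [cite: LuscherWolff1990]; C. Davis, W. M. Kahan, SIAM J. Numer. Anal. 7 (1970) 1 [cite: DavisKahan1970, §2].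
-/

set_option autoImplicit false

noncomputable section

open MeasureTheory Filter Topology Real
open Literature.MathematicalPhysics.QuantumFieldTheory (GaugeConfig Site gaugeTransform)
open Literature.Analysis.OperatorTheory.YMMatrixModel
open scoped BigOperators

namespace Summit.QuantumFields.YangMills.Theorems.FemtoTransferGap.PolyakovLift

open Summit.QuantumFields.YangMills.Theorems.FemtoTransferGap

variable {L : ℕ} [NeZero L]

/-! ## §1 Almost-eigenvectors with separated Rayleigh quotients are almost orthogonal -/

/-- Pairing a physical `u` with the residual `Kv − c·v`: `⟨u, Kv − c v⟩ = ⟨u,Kv⟩ − c⟨u,v⟩`. [folklore] -/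
theorem l2_residual_right (β : ℝ) {u v : GaugeConfig 3 L SU2 → ℝ} (hu : IsPhys u) (hv : IsPhys v) (c : ℝ) :
    l2 u (transferApply β v + (-c) • v) = l2 u (transferApply β v) - c * l2 u v := by
  rw [l2_comm u, l2_add_left (isPhys_transferApply β hv) (hv.smul _) hu, l2_smul_left, l2_comm (transferApply β v) u, l2_comm v u]
  ring

/-- Norm of the residual at the Rayleigh quotient: `‖Kv − d̂_v v‖² = ‖Kv‖² − ⟨v,Kv⟩²/‖v‖²` (`d̂_v = ⟨v,Kv⟩/‖v‖²`, `‖v‖² > 0`). [folklore] -/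
theorem l2_residual_self (β : ℝ) {v : GaugeConfig 3 L SU2 → ℝ} (hv : IsPhys v) (hn : 0 < l2 v v) :
    l2 (transferApply β v + (-(l2 v (transferApply β v) / l2 v v)) • v)
        (transferApply β v + (-(l2 v (transferApply β v) / l2 v v)) • v) =
      l2 (transferApply β v) (transferApply β v) - l2 v (transferApply β v) ^ 2 / l2 v v := by
  set c : ℝ := l2 v (transferApply β v) / l2 v v with hc
  have hKv : IsPhys (transferApply β v) := isPhys_transferApply β hv
  have hr : IsPhys (transferApply β v + (-c) • v) := hKv.add (hv.smul _)
  rw [l2_add_left hKv (hv.smul _) hr, l2_smul_left, l2_residual_right β hKv hv c, l2_residual_right β hv hv c,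
    l2_comm (transferApply β v) v]
  have hn0 : l2 v v ≠ 0 := hn.ne'
  rw [hc]
  field_simp
  ring

/-- **Cauchy–Schwarz against a small residual**: `‖u‖², ‖v‖² > 0`, `V_v = ‖Kv‖²‖v‖² − ⟨v,Kv⟩² ≤ ρ²‖v‖⁴`, `ρ ≥ 0` ⟹ `|⟨u, Kv − d̂_v v⟩| ≤ ρ‖u‖‖v‖`.
[folklore] -/
theorem abs_l2_residual_le (β : ℝ) {u v : GaugeConfig 3 L SU2 → ℝ} (hu : IsPhys u) (hv : IsPhys v) (hnu : 0 < l2 u u) (hnv : 0 < l2 v v)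
    {ρ : ℝ} (hρ : 0 ≤ ρ)
    (hV : l2 (transferApply β v) (transferApply β v) * l2 v v - l2 v (transferApply β v) ^ 2 ≤ ρ ^ 2 * l2 v v ^ 2) :
    |l2 u (transferApply β v + (-(l2 v (transferApply β v) / l2 v v)) • v)| ≤ ρ * (Real.sqrt (l2 u u) * Real.sqrt (l2 v v)) := by
  set r := transferApply β v + (-(l2 v (transferApply β v) / l2 v v)) • v with hr
  have hrP : IsPhys r := (isPhys_transferApply β hv).add (hv.smul _)
  have hrr : l2 r r ≤ ρ ^ 2 * l2 v v := by
    rw [hr, l2_residual_self β hv hnv]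
    refine le_of_mul_le_mul_right ?_ hnv
    rw [sub_mul, div_mul_cancel₀ _ hnv.ne']
    calc l2 (transferApply β v) (transferApply β v) * l2 v v - l2 v (transferApply β v) ^ 2 ≤ ρ ^ 2 * l2 v v ^ 2 := hV
      _ = ρ ^ 2 * l2 v v * l2 v v := by ring
  have hcs : l2 u r ^ 2 ≤ l2 u u * l2 r r := sq_l2_le hu hrP
  have hsq : l2 u r ^ 2 ≤ (ρ * (Real.sqrt (l2 u u) * Real.sqrt (l2 v v))) ^ 2 := by
    have e : (ρ * (Real.sqrt (l2 u u) * Real.sqrt (l2 v v))) ^ 2 = ρ ^ 2 * (l2 u u * l2 v v) := by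
      rw [mul_pow, mul_pow, Real.sq_sqrt hnu.le, Real.sq_sqrt hnv.le]
    rw [e]
    calc l2 u r ^ 2 ≤ l2 u u * l2 r r := hcs
      _ ≤ l2 u u * (ρ ^ 2 * l2 v v) := mul_le_mul_of_nonneg_left hrr hnu.le
      _ = ρ ^ 2 * (l2 u u * l2 v v) := by ring
  exact abs_le_of_sq_le_sq hsq (by positivity)

/-- ★ **Almost-eigenvectors with separated Rayleigh quotients are almost orthogonal.**  For physical `u, v` with `‖u‖², ‖v‖² > 0`, variances
`V_u ≤ ρ²‖u‖⁴`, `V_v ≤ ρ²‖v‖⁴` (`V = ‖K·‖²‖·‖² − ⟨·,K·⟩²`, the left side of (o4)) and Rayleigh gap `0 < γ ≤ |⟨u,Ku⟩/‖u‖² − ⟨v,Kv⟩/‖v‖²|`: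
`|⟨u,v⟩| ≤ (2ρ/γ)·‖u‖‖v‖`.  (`K_β` symmetric on physical functions: `l2_transferApply_comm`.) [cite: DavisKahan1970, §2] -/
theorem abs_l2_le_of_residual_gap (β : ℝ) {u v : GaugeConfig 3 L SU2 → ℝ} (hu : IsPhys u) (hv : IsPhys v) (hnu : 0 < l2 u u) (hnv : 0 < l2 v v)
    {ρ γ : ℝ} (hρ : 0 ≤ ρ) (hγ : 0 < γ)
    (hVu : l2 (transferApply β u) (transferApply β u) * l2 u u - l2 u (transferApply β u) ^ 2 ≤ ρ ^ 2 * l2 u u ^ 2)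
    (hVv : l2 (transferApply β v) (transferApply β v) * l2 v v - l2 v (transferApply β v) ^ 2 ≤ ρ ^ 2 * l2 v v ^ 2)
    (hgap : γ ≤ |l2 u (transferApply β u) / l2 u u - l2 v (transferApply β v) / l2 v v|) :
    |l2 u v| ≤ 2 * ρ / γ * (Real.sqrt (l2 u u) * Real.sqrt (l2 v v)) := by
  set cu : ℝ := l2 u (transferApply β u) / l2 u u with hcu
  set cv : ℝ := l2 v (transferApply β v) / l2 v v with hcv
  have h1 : |l2 u (transferApply β v + (-cv) • v)| ≤ ρ * (Real.sqrt (l2 u u) * Real.sqrt (l2 v v)) :=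
    abs_l2_residual_le β hu hv hnu hnv hρ hVv
  have h2 : |l2 v (transferApply β u + (-cu) • u)| ≤ ρ * (Real.sqrt (l2 u u) * Real.sqrt (l2 v v)) := by
    rw [mul_comm (Real.sqrt (l2 u u))]
    exact abs_l2_residual_le β hv hu hnv hnu hρ hVu
  have e1 : l2 u (transferApply β v + (-cv) • v) = l2 u (transferApply β v) - cv * l2 u v := l2_residual_right β hu hv cv
  have e2 : l2 v (transferApply β u + (-cu) • u) = l2 u (transferApply β v) - cu * l2 u v := by
    rw [l2_residual_right β hv hu cu, l2_comm v (transferApply β u), l2_transferApply_comm β hu hv, l2_comm v u]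
  have hkey : (cu - cv) * l2 u v = l2 u (transferApply β v + (-cv) • v) - l2 v (transferApply β u + (-cu) • u) := by
    rw [e1, e2]; ring
  have hprod : |cu - cv| * |l2 u v| ≤ 2 * (ρ * (Real.sqrt (l2 u u) * Real.sqrt (l2 v v))) := by
    rw [← abs_mul, hkey]
    exact (abs_sub _ _).trans (by linarith)
  have hγ' : γ * |l2 u v| ≤ 2 * (ρ * (Real.sqrt (l2 u u) * Real.sqrt (l2 v v))) :=
    (mul_le_mul_of_nonneg_right hgap (abs_nonneg _)).trans hprod
  rw [mul_comm] at hγ'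
  rw [div_mul_eq_mul_div, le_div_iff₀ hγ]
  linarith

/-! ## §2 Rayleigh gap from the Lüscher position and the one-site level gap -/

/-- **(o5) for two channels ⟹ Rayleigh gap** (pure real): from the LOWER half of (o5) for `i`, `μ_i λ₀ n_i ≤ e^{η} d_i m₀`, and the UPPER half for `l`,
`d_l m₀ ≤ e^{η} μ_l λ₀ n_l` (`m₀, n_i, n_l > 0`): `(λ₀/m₀)(e^{−η}μ_i − e^{η}μ_l) ≤ d_i/n_i − d_l/n_l`. [cite: Luscher1983, §3] -/
theorem rayleighGap_of_position {m0 l0 η μi μl di dl ni nl : ℝ} (hm0 : 0 < m0) (hni : 0 < ni) (hnl : 0 < nl)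
    (h5i : μi * l0 * ni ≤ Real.exp η * (di * m0)) (h5l : dl * m0 ≤ Real.exp η * (μl * l0) * nl) :
    l0 / m0 * (Real.exp (-η) * μi - Real.exp η * μl) ≤ di / ni - dl / nl := by
  have hen : Real.exp (-η) * Real.exp η = 1 := by rw [← Real.exp_add]; simp
  have hi : l0 / m0 * (Real.exp (-η) * μi) ≤ di / ni := by
    rw [le_div_iff₀ hni, div_mul_eq_mul_div, mul_comm, ← mul_div_assoc, div_le_iff₀ hm0]
    have h1 : Real.exp (-η) * (μi * l0 * ni) ≤ Real.exp (-η) * (Real.exp η * (di * m0)) :=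
      mul_le_mul_of_nonneg_left h5i (Real.exp_pos _).le
    calc ni * (l0 * (Real.exp (-η) * μi)) = Real.exp (-η) * (μi * l0 * ni) := by ring
      _ ≤ Real.exp (-η) * (Real.exp η * (di * m0)) := h1
      _ = di * m0 := by rw [← mul_assoc, hen, one_mul]
  have hl : dl / nl ≤ l0 / m0 * (Real.exp η * μl) := by
    rw [div_le_iff₀ hnl, div_mul_eq_mul_div, div_mul_eq_mul_div, le_div_iff₀ hm0]
    calc dl * m0 ≤ Real.exp η * (μl * l0) * nl := h5l
      _ = l0 * (Real.exp η * μl) * nl := by ring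
  calc l0 / m0 * (Real.exp (-η) * μi - Real.exp η * μl)
      = l0 / m0 * (Real.exp (-η) * μi) - l0 / m0 * (Real.exp η * μl) := by ring
    _ ≤ di / ni - dl / nl := sub_le_sub hi hl

/-- **The one-site gap survives the (o5) slack** (pure real): `μ_j − μ_{j'} ≥ c·ν·x`, `0 ≤ μ_{j'} ≤ 2ν`, `ν ≥ 0`, `0 ≤ η ≤ 1/2` with `η(2c x + 8) ≤ (c/2)x`
⟹ `e^{−η}μ_j − e^{η}μ_{j'} ≥ (c/2)νx` (`|e^{±η} − 1| ≤ 2η`, `Real.abs_exp_sub_one_le`). [cite: Luscher1983, §2] -/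
theorem gap_through_slack {μj μj' ν x c η : ℝ} (hν : 0 ≤ ν) (hc : 0 ≤ c) (hx : 0 ≤ x) (hμj'0 : 0 ≤ μj') (hμj' : μj' ≤ 2 * ν)
    (hgap : c * ν * x ≤ μj - μj') (hη0 : 0 ≤ η) (hη : η ≤ 1 / 2) (hsmall : η * (2 * c * x + 8) ≤ c / 2 * x) :
    c / 2 * ν * x ≤ Real.exp (-η) * μj - Real.exp η * μj' := by
  have h1 := Real.abs_exp_sub_one_le (show |η| ≤ 1 by rw [abs_of_nonneg hη0]; linarith)
  have h2 := Real.abs_exp_sub_one_le (show |(-η)| ≤ 1 by rw [abs_neg, abs_of_nonneg hη0]; linarith)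
  rw [abs_of_nonneg hη0] at h1
  rw [abs_neg, abs_of_nonneg hη0] at h2
  have hlo : 1 - 2 * η ≤ Real.exp (-η) := by linarith [(abs_le.mp h2).1]
  have hhi : Real.exp η ≤ 1 + 2 * η := by linarith [(abs_le.mp h1).2]
  have hμj : μj' + c * ν * x ≤ μj := by linarith
  have hμj0 : 0 ≤ μj := le_trans (by positivity) hμj
  have h12 : 0 ≤ 1 - 2 * η := by linarith
  have hA : (1 - 2 * η) * (μj' + c * ν * x) ≤ Real.exp (-η) * μj :=
    (mul_le_mul_of_nonneg_left hμj h12).trans (mul_le_mul_of_nonneg_right hlo hμj0)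
  have hB : Real.exp η * μj' ≤ (1 + 2 * η) * μj' := mul_le_mul_of_nonneg_right hhi hμj'0
  have hC : c / 2 * ν * x ≤ (1 - 2 * η) * (μj' + c * ν * x) - (1 + 2 * η) * μj' := by
    have h4 : 4 * η * μj' ≤ 8 * η * ν := by nlinarith
    have h5 : ν * (η * (2 * c * x + 8)) ≤ ν * (c / 2 * x) := mul_le_mul_of_nonneg_left hsmall hν
    nlinarith
  linarith

/-- **Rayleigh separation at a window point** (pure real): one-site data `0 < m₀ ≤ 2ν`, `0 ≤ μ_b ≤ m₀`, gap `c·ν·x ≤ μ_a − μ_b`, slack `0 ≤ η ≤ 1/2` with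
`η(2cx + 8) ≤ (c/2)x`, and the two (o5) halves `μ_a λ₀ n_a ≤ e^{η} d_a m₀`, `d_b m₀ ≤ e^{η} μ_b λ₀ n_b` (`n_a, n_b > 0`, `λ₀ > 0`)
⟹ `(c/4)·x·λ₀ ≤ d_a/n_a − d_b/n_b`. [cite: Luscher1983, §3] -/
theorem rayleighSep_window {m0 l0 ν x c η μa μb da db na nb : ℝ} (hm0 : 0 < m0) (hl0 : 0 < l0) (hm0le : m0 ≤ 2 * ν)
    (hc : 0 ≤ c) (hx : 0 ≤ x) (hμb0 : 0 ≤ μb) (hμb : μb ≤ m0) (hgap : c * ν * x ≤ μa - μb) (hη0 : 0 ≤ η) (hη : η ≤ 1 / 2)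
    (hsmall : η * (2 * c * x + 8) ≤ c / 2 * x) (hna : 0 < na) (hnb : 0 < nb)
    (h5a : μa * l0 * na ≤ Real.exp η * (da * m0)) (h5b : db * m0 ≤ Real.exp η * (μb * l0) * nb) :
    c / 4 * x * l0 ≤ da / na - db / nb := by
  have hν : 0 ≤ ν := by linarith
  have h1 : c / 2 * ν * x ≤ Real.exp (-η) * μa - Real.exp η * μb :=
    gap_through_slack hν hc hx hμb0 (hμb.trans hm0le) hgap hη0 hη hsmall
  have h2 : l0 / m0 * (Real.exp (-η) * μa - Real.exp η * μb) ≤ da / na - db / nb :=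
    rayleighGap_of_position hm0 hna hnb h5a h5b
  have h3 : c / 4 * x * l0 ≤ l0 / m0 * (c / 2 * ν * x) := by
    have e : c / 4 * x * l0 = l0 / m0 * (c / 2 * (m0 / 2) * x) := by
      field_simp
      ring
    rw [e]
    have hνm : m0 / 2 ≤ ν := by linarith
    exact mul_le_mul_of_nonneg_left (mul_le_mul_of_nonneg_right (mul_le_mul_of_nonneg_left hνm (by positivity)) hx)
      (by positivity)
  exact h3.trans ((mul_le_mul_of_nonneg_left h1 (by positivity)).trans h2)

/-! ## §3 ★ Static clauses from sharp leakage and Rayleigh separation (clause level) -/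

/-- ★ **Both static clauses from SHARP LEAKAGE + RAYLEIGH SEPARATION, pair by pair mixed with exact symmetric pairs.**  For the dressed lifts
`u = dressedLiftFamily β φ g` of a physical one-site basis: (o0); sharp (o4) `V_i ≤ C₄(λ⁴/L²)λ₀²n_i²` for every channel; and for each pair `i ≠ l` EITHER
`PairSeparated (g i) (g l)` OR `γ₀(λ/L)λ₀ ≤ |d̂_i − d̂_l|` (`γ₀ > 0`, `λ = luscherLambda β L > 0`, `λ₀ = levelValue su2Rep L β 0 > 0`)
⟹ `StaticClauses k (2√C₄/γ₀) β u`. [cite: Luscher1983, §3] [cite: LuscherWolff1990] [cite: DavisKahan1970, §2] -/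
theorem staticClauses_of_sharpLeakage_rayleighSep (β : ℝ) {φ : GaugeConfig 3 L SU2 → ℝ} (hvac : IsRawVacuum β φ) {k : ℕ}
    {g : Fin k → (Cfg → ℝ)} (hg : ∀ i, IsPhys (g i)) (hlam : 0 < luscherLambda β L)
    (h0 : ∀ i : Fin k, 0 < l2 (dressedLiftFamily β φ g i) (dressedLiftFamily β φ g i))
    {C₄ : ℝ} (hC₄ : 0 ≤ C₄)
    (h4 : ∀ i : Fin k,
      l2 (transferApply β (dressedLiftFamily β φ g i)) (transferApply β (dressedLiftFamily β φ g i)) *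
            l2 (dressedLiftFamily β φ g i) (dressedLiftFamily β φ g i) -
          l2 (dressedLiftFamily β φ g i) (transferApply β (dressedLiftFamily β φ g i)) ^ 2
        ≤ C₄ * (luscherLambda β L ^ 4 / (L : ℝ) ^ 2) * levelValue su2Rep L β 0 ^ 2 *
            l2 (dressedLiftFamily β φ g i) (dressedLiftFamily β φ g i) ^ 2)
    {γ₀ : ℝ} (hγ₀ : 0 < γ₀)
    (hsep : ∀ i l : Fin k, i ≠ l → PairSeparated (g i) (g l) ∨
      γ₀ * (luscherLambda β L / L) * levelValue su2Rep L β 0 ≤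
        |l2 (dressedLiftFamily β φ g i) (transferApply β (dressedLiftFamily β φ g i)) /
              l2 (dressedLiftFamily β φ g i) (dressedLiftFamily β φ g i) -
            l2 (dressedLiftFamily β φ g l) (transferApply β (dressedLiftFamily β φ g l)) /
              l2 (dressedLiftFamily β φ g l) (dressedLiftFamily β φ g l)|) :
    StaticClauses k (2 * Real.sqrt C₄ / γ₀) β (dressedLiftFamily β φ g) := by
  have hL : (0 : ℝ) < (L : ℝ) := by exact_mod_cast Nat.pos_of_ne_zero (NeZero.ne L)
  have hl0 : 0 < levelValue su2Rep L β 0 := levelValue_zero_su2Rep_pos L β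
  have hphys : ∀ i, IsPhys (dressedLiftFamily β φ g i) := fun i => isPhys_dressedLiftVec β hvac.1 (hg i)
  set lam := luscherLambda β L with hlamdef
  set ρ : ℝ := Real.sqrt C₄ * (lam ^ 2 / L) * levelValue su2Rep L β 0 with hρ
  set γ : ℝ := γ₀ * (lam / L) * levelValue su2Rep L β 0 with hγ
  have hρ0 : 0 ≤ ρ := by positivity
  have hγpos : 0 < γ := by positivity
  have hρsq : ∀ i : Fin k, C₄ * (lam ^ 4 / (L : ℝ) ^ 2) * levelValue su2Rep L β 0 ^ 2 *
      l2 (dressedLiftFamily β φ g i) (dressedLiftFamily β φ g i) ^ 2 =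
        ρ ^ 2 * l2 (dressedLiftFamily β φ g i) (dressedLiftFamily β φ g i) ^ 2 := by
    intro i
    rw [hρ, mul_pow, mul_pow, Real.sq_sqrt hC₄]
    field_simp
  have hratio : 2 * ρ / γ = 2 * Real.sqrt C₄ / γ₀ * lam := by
    rw [hρ, hγ]
    field_simp
  refine ⟨h0, fun i l hil => ?_⟩
  rcases hsep i l hil with hS | hG
  · have h00 : l2 (dressedLiftFamily β φ g i) (dressedLiftFamily β φ g l) = 0 :=
      (dressed_pair_eq_zero_of_pairSeparated β hvac (hg i) (hg l) hS).1
    rw [h00, abs_zero]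
    exact mul_nonneg (mul_nonneg (by positivity) hlam.le) (mul_nonneg (Real.sqrt_nonneg _) (Real.sqrt_nonneg _))
  · have hb := abs_l2_le_of_residual_gap β (hphys i) (hphys l) (h0 i) (h0 l) hρ0 hγpos
      ((h4 i).trans (le_of_eq (hρsq i))) ((h4 l).trans (le_of_eq (hρsq l))) hG
    rwa [hratio] at hb

/-! ## §4 ★★ The r7 stub text from the two spectral certificates -/

/-- ★★ **`StaticsForL (TransplantBasisLR k)` from a SHARP-LEAKAGE + RAYLEIGH-SEPARATION certificate** (deep in the window, every raw vacuum, every r7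
basis: sharp (o4) at rate `λ⁴/L²` ∀ channels and, per pair `i ≠ l`, `PairSeparated (g i) (g l)` or `γ₀(λ/L)λ₀ ≤ |d̂_i − d̂_l|`) — conclusion with `C = 2√C₄/γ₀`;
(o0) is the tree's `o0_level_transplantLR`. [cite: Luscher1983, §3] [cite: LuscherWolff1990] [cite: DavisKahan1970, §2] -/
theorem staticsForLR_of_leakageRayleighCert (k : ℕ)
    (hcert : ∃ C₄ γ₀ lam1 : ℝ, 0 ≤ C₄ ∧ 0 < γ₀ ∧ 0 < lam1 ∧ ∀ lam : ℝ, 0 < lam → lam ≤ lam1 → ∃ L0 : ℕ,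
      ∀ (L : ℕ) [NeZero L], L0 ≤ L → ∀ β : ℝ, InFemtoWindow lam β L → ∀ φ : GaugeConfig 3 L SU2 → ℝ, IsRawVacuum β φ →
        ∀ g : Fin k → (Cfg → ℝ), TransplantBasisLR k L (luscherLambda β L) g →
          (∀ i : Fin k,
            l2 (transferApply β (dressedLiftFamily β φ g i)) (transferApply β (dressedLiftFamily β φ g i)) *
                  l2 (dressedLiftFamily β φ g i) (dressedLiftFamily β φ g i) -
                l2 (dressedLiftFamily β φ g i) (transferApply β (dressedLiftFamily β φ g i)) ^ 2
              ≤ C₄ * (luscherLambda β L ^ 4 / (L : ℝ) ^ 2) * levelValue su2Rep L β 0 ^ 2 *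
                  l2 (dressedLiftFamily β φ g i) (dressedLiftFamily β φ g i) ^ 2) ∧
          (∀ i l : Fin k, i ≠ l → PairSeparated (g i) (g l) ∨
            γ₀ * (luscherLambda β L / L) * levelValue su2Rep L β 0 ≤
              |l2 (dressedLiftFamily β φ g i) (transferApply β (dressedLiftFamily β φ g i)) /
                    l2 (dressedLiftFamily β φ g i) (dressedLiftFamily β φ g i) -
                  l2 (dressedLiftFamily β φ g l) (transferApply β (dressedLiftFamily β φ g l)) /
                    l2 (dressedLiftFamily β φ g l) (dressedLiftFamily β φ g l)|)) :
    StaticsForL (TransplantBasisLR k) := by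
  obtain ⟨C₄, γ₀, lam1, hC₄, hγ₀, hlam1, h⟩ := hcert
  obtain ⟨lamO, hlamO, hO⟩ := o0_level_transplantLR k
  refine ⟨2 * Real.sqrt C₄ / γ₀, min lam1 lamO, by positivity, lt_min hlam1 hlamO, fun lam hlam hle => ?_⟩
  obtain ⟨L0, hL0⟩ := h lam hlam (hle.trans (min_le_left _ _))
  refine ⟨L0, fun L _ hL β hW φ hvac g hbasis => ?_⟩
  obtain ⟨h4, hsep⟩ := hL0 L hL β hW φ hvac g hbasis
  have hlampos : 0 < luscherLambda β L := lt_of_lt_of_le hlam hW.2.1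
  exact staticClauses_of_sharpLeakage_rayleighSep β hvac (basisPhysL_transplantBasisLR k L _ g hbasis) hlampos
    (hO lam hlam (hle.trans (min_le_right _ _)) L β hW φ hvac g hbasis) hC₄ h4 hγ₀ hsep

/-- ★★ **`StaticsForL (TransplantBasisLR k)` from a SHARP-LEAKAGE + POSITION certificate, the level gaps DISCHARGED by the closed crux ONE** (deep in
the window, every raw vacuum, every r7 basis: sharp (o4) at rate `λ⁴/L²` and BOTH halves of the Lüscher position (o5) ∀ channels — VERBATIM the first conjunct
of `DynamicCoreClauses k C₅ β u` — and, per pair `i ≠ l`, `PairSeparated (g i) (g l)` or DISTINCT one-site levels `physLevel (i+2) ≠ physLevel (l+2)`);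
constant `8√C₄/c_gap` with `c_gap` the uniform gap constant of `PScal.levels_package k`. [cite: Luscher1983, §3] [cite: LuscherWolff1990] [cite: DavisKahan1970, §2] -/
theorem staticsForLR_of_leakagePositionCert (k : ℕ)
    (hcert : ∃ C₄ C₅ lam1 : ℝ, 0 ≤ C₄ ∧ 0 ≤ C₅ ∧ 0 < lam1 ∧ ∀ lam : ℝ, 0 < lam → lam ≤ lam1 → ∃ L0 : ℕ,
      ∀ (L : ℕ) [NeZero L], L0 ≤ L → ∀ β : ℝ, InFemtoWindow lam β L → ∀ φ : GaugeConfig 3 L SU2 → ℝ, IsRawVacuum β φ →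
        ∀ g : Fin k → (Cfg → ℝ), TransplantBasisLR k L (luscherLambda β L) g →
          (∀ i : Fin k,
            l2 (transferApply β (dressedLiftFamily β φ g i)) (transferApply β (dressedLiftFamily β φ g i)) *
                  l2 (dressedLiftFamily β φ g i) (dressedLiftFamily β φ g i) -
                l2 (dressedLiftFamily β φ g i) (transferApply β (dressedLiftFamily β φ g i)) ^ 2
              ≤ C₄ * (luscherLambda β L ^ 4 / (L : ℝ) ^ 2) * levelValue su2Rep L β 0 ^ 2 *
                  l2 (dressedLiftFamily β φ g i) (dressedLiftFamily β φ g i) ^ 2) ∧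
          (∀ i : Fin k,
            l2 (dressedLiftFamily β φ g i) (transferApply β (dressedLiftFamily β φ g i)) * levelValue su2Rep 1 (oneSiteCoupling β L) 0 ≤
                Real.exp (C₅ * luscherLambda β L ^ 2 / L) *
                  (levelValue su2Rep 1 (oneSiteCoupling β L) ((i : ℕ) + 1) * levelValue su2Rep L β 0) *
                    l2 (dressedLiftFamily β φ g i) (dressedLiftFamily β φ g i) ∧
            levelValue su2Rep 1 (oneSiteCoupling β L) ((i : ℕ) + 1) * levelValue su2Rep L β 0 *
                  l2 (dressedLiftFamily β φ g i) (dressedLiftFamily β φ g i) ≤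
                Real.exp (C₅ * luscherLambda β L ^ 2 / L) *
                  (l2 (dressedLiftFamily β φ g i) (transferApply β (dressedLiftFamily β φ g i)) * levelValue su2Rep 1 (oneSiteCoupling β L) 0)) ∧
          (∀ i l : Fin k, i ≠ l → PairSeparated (g i) (g l) ∨ physLevel ((i : ℕ) + 2) ≠ physLevel ((l : ℕ) + 2))) :
    StaticsForL (TransplantBasisLR k) := by
  obtain ⟨C₄, C₅, lam1, hC₄, hC₅, hlam1, h⟩ := hcert
  obtain ⟨C, cgap, Ctop, x₀, B₁, -, hcgap, -, -, -, hpk⟩ := PScal.levels_package k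
  obtain ⟨lamO, hlamO, hO⟩ := o0_level_transplantLR k
  -- smallness of `λ`: `λ ≤ 1`, `B(β,L) ≥ B₁`, `C₅ λ (2 c_gap + 8) ≤ c_gap / 2`, and `lam ≤ lamO`
  set lamS : ℝ := cgap / (2 * C₅ * (2 * cgap + 8) + 1) with hlamS
  have hlamS0 : 0 < lamS := by positivity
  set lam2 : ℝ := min (min lam1 (1 / 2)) (min (1 / (4 * max B₁ 1)) (min (lamS / 2) lamO)) with hlam2
  have hlam2pos : 0 < lam2 :=
    lt_min (lt_min hlam1 (by norm_num)) (lt_min (by positivity) (lt_min (by positivity) hlamO))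
  refine staticsForLR_of_leakageRayleighCert k ⟨C₄, cgap / 4, lam2, hC₄, by positivity, hlam2pos, fun lam hlam hle => ?_⟩
  have hle1 : lam ≤ lam1 := hle.trans ((min_le_left _ _).trans (min_le_left _ _))
  have hlehalf : lam ≤ 1 / 2 := hle.trans ((min_le_left _ _).trans (min_le_right _ _))
  have hleB : lam ≤ 1 / (4 * max B₁ 1) := hle.trans ((min_le_right _ _).trans (min_le_left _ _))
  have hleS : lam ≤ lamS / 2 := hle.trans ((min_le_right _ _).trans ((min_le_right _ _).trans (min_le_left _ _)))
  have hleO : lam ≤ lamO := hle.trans ((min_le_right _ _).trans ((min_le_right _ _).trans (min_le_right _ _)))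
  obtain ⟨L0, hL0⟩ := h lam hlam hle1
  refine ⟨L0, fun L _ hL β hW φ hvac g hbasis => ?_⟩
  obtain ⟨h4, h5, hsep⟩ := hL0 L hL β hW φ hvac g hbasis
  have hnn : ∀ j : Fin k, 0 < l2 (dressedLiftFamily β φ g j) (dressedLiftFamily β φ g j) := hO lam hlam hleO L β hW φ hvac g hbasis
  refine ⟨h4, fun i l hil => ?_⟩
  rcases hsep i l hil with hS | hne
  · exact Or.inl hS
  right
  have hLpos : (0 : ℝ) < (L : ℝ) := by exact_mod_cast Nat.pos_of_ne_zero (NeZero.ne L)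
  have hL1 : (1 : ℝ) ≤ (L : ℝ) := by exact_mod_cast NeZero.one_le
  have hlampos : 0 < luscherLambda β L := lt_of_lt_of_le hlam hW.2.1
  have hlamle : luscherLambda β L ≤ 2 * lam := hW.2.2
  have hlam_le_one : luscherLambda β L ≤ 1 := by linarith
  have hlam_le_S : luscherLambda β L ≤ lamS := by linarith
  have hB : B₁ ≤ oneSiteCoupling β L := KTGen.oneSiteCoupling_ge_of_small_level hlam (by linarith) hleB hW
  have hB0 : 0 ≤ oneSiteCoupling β L := KTRCalibration.oneSiteCoupling_nonneg β L
  obtain ⟨-, -, -, -, hab, h0b, hGAP, -⟩ := hpk _ hB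
  have hxeq : bareLambda (oneSiteCoupling β L) = luscherLambda β L / L := bareLambda_oneSiteCoupling hlampos
  rw [hxeq] at hGAP
  have hx0 : 0 ≤ luscherLambda β L / L := div_nonneg hlampos.le hLpos.le
  have hx1 : luscherLambda β L / L ≤ 1 := by rw [div_le_one hLpos]; exact hlam_le_one.trans hL1
  have hl0 : 0 < levelValue su2Rep L β 0 := levelValue_zero_su2Rep_pos L β
  have hm0pos : 0 < levelValue su2Rep 1 (oneSiteCoupling β L) 0 := (hab 0 (Nat.zero_le k)).2.2
  have hm0le : levelValue su2Rep 1 (oneSiteCoupling β L) 0 ≤ 2 * linkC (oneSiteCoupling β L) ^ 3 := h0b.2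
  have hμle : ∀ j : ℕ, levelValue su2Rep 1 (oneSiteCoupling β L) j ≤ levelValue su2Rep 1 (oneSiteCoupling β L) 0 := fun j =>
    KTRCalibration.levelValue_antitone (L := 1) hB0 (Nat.zero_le j)
  have hμ0 : ∀ j : ℕ, j ≤ k → 0 ≤ levelValue su2Rep 1 (oneSiteCoupling β L) j := fun j hj => (hab j hj).2.2.le
  -- the slack `η = C₅ λ²/L`: `η ≤ 1/2` and `η (2 c_gap x + 8) ≤ (c_gap/2) x`
  have hηx : C₅ * luscherLambda β L ^ 2 / L = C₅ * luscherLambda β L * (luscherLambda β L / L) := by ring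
  have hη0 : 0 ≤ C₅ * luscherLambda β L ^ 2 / L := by positivity
  have hkey : C₅ * luscherLambda β L * (2 * cgap + 8) ≤ cgap / 2 := by
    have h1 : C₅ * luscherLambda β L * (2 * cgap + 8) ≤ C₅ * lamS * (2 * cgap + 8) :=
      mul_le_mul_of_nonneg_right (mul_le_mul_of_nonneg_left hlam_le_S hC₅) (by positivity)
    have h2 : C₅ * lamS * (2 * cgap + 8) ≤ cgap / 2 := by
      rw [hlamS, show C₅ * (cgap / (2 * C₅ * (2 * cgap + 8) + 1)) * (2 * cgap + 8) =
          cgap * (C₅ * (2 * cgap + 8)) / (2 * C₅ * (2 * cgap + 8) + 1) by ring, div_le_iff₀ (by positivity)]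
      nlinarith [hcgap, hC₅]
    exact h1.trans h2
  have hηhalf : C₅ * luscherLambda β L ^ 2 / L ≤ 1 / 2 := by
    rw [hηx]
    have h2 : C₅ * lamS ≤ 1 / 4 := by
      rw [hlamS, ← mul_div_assoc, div_le_iff₀ (by positivity)]
      nlinarith [hcgap, hC₅]
    have h1 : C₅ * luscherLambda β L ≤ C₅ * lamS := mul_le_mul_of_nonneg_left hlam_le_S hC₅
    calc C₅ * luscherLambda β L * (luscherLambda β L / L) ≤ C₅ * luscherLambda β L * 1 := mul_le_mul_of_nonneg_left hx1 (by positivity)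
      _ ≤ 1 / 2 := by linarith
  have hsmall : C₅ * luscherLambda β L ^ 2 / L * (2 * cgap * (luscherLambda β L / L) + 8) ≤ cgap / 2 * (luscherLambda β L / L) := by
    rw [hηx]
    calc C₅ * luscherLambda β L * (luscherLambda β L / L) * (2 * cgap * (luscherLambda β L / L) + 8)
        = C₅ * luscherLambda β L * (2 * cgap * (luscherLambda β L / L) + 8) * (luscherLambda β L / L) := by ring
      _ ≤ C₅ * luscherLambda β L * (2 * cgap + 8) * (luscherLambda β L / L) := by
          apply mul_le_mul_of_nonneg_right _ hx0
          apply mul_le_mul_of_nonneg_left _ (by positivity)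
          nlinarith [hcgap.le, hx1, hx0]
      _ ≤ cgap / 2 * (luscherLambda β L / L) := mul_le_mul_of_nonneg_right hkey hx0
  have hik : (i : ℕ) + 1 ≤ k := by omega
  have hlk : (l : ℕ) + 1 ≤ k := by omega
  have ei : (i : ℕ) + 1 + 1 = (i : ℕ) + 2 := rfl
  have el : (l : ℕ) + 1 + 1 = (l : ℕ) + 2 := rfl
  rcases lt_or_gt_of_ne hne with hlt | hgt
  · -- `E_{i+2} < E_{l+2}`: `d̂_i − d̂_l ≥ (c_gap/4)(λ/L)λ₀`
    have hg := hGAP ((i : ℕ) + 1) ((l : ℕ) + 1) hik hlk (by rw [ei, el]; exact hlt)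
    have hsepw := rayleighSep_window hm0pos hl0 hm0le hcgap.le hx0 (hμ0 _ hlk) (hμle _) hg hη0 hηhalf hsmall (hnn i) (hnn l)
      (h5 i).2 (h5 l).1
    exact hsepw.trans (le_abs_self _)
  · -- `E_{l+2} < E_{i+2}`: `d̂_l − d̂_i ≥ (c_gap/4)(λ/L)λ₀`
    have hg := hGAP ((l : ℕ) + 1) ((i : ℕ) + 1) hlk hik (by rw [ei, el]; exact hgt)
    have hsepw := rayleighSep_window hm0pos hl0 hm0le hcgap.le hx0 (hμ0 _ hik) (hμle _) hg hη0 hηhalf hsmall (hnn l) (hnn i)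
      (h5 l).2 (h5 i).1
    rw [abs_sub_comm]
    exact hsepw.trans (le_abs_self _)

end Summit.QuantumFields.YangMills.Theorems.FemtoTransferGap.PolyakovLift

end
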